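import Summits.Ventures.QEC.Census.Additive.C1RegisterLargeB
import Summits.Ventures.QEC.Census.AdditiveCertLanesSound
import Summits.Ventures.QEC.Census.AdditivePropagation
import HarnessLib

/-!
# CRSS 1998 Table III lower column — register codes (III): the double-circulant [[16,0,6]] at tier KERNEL-std (KERNEL-std through the lane engine; no definitions)

Venture QEC (cell `qec`), census calibration (qec-search-5, gen 2). This file re-derives, at the standard-axiom tier, the printed-generator REGISTER codes (Gottesman 1997 / CRSS 1998 Tables I–II and constructions, qec-search-5 gen 0 `c1-register`, files `Census/Additive/C1Register*.lean`) whose `AddCert` certificates were closed by `native_decide`: the SAME tree certificates now pass the lane engine by `decide +kernel`. For the cells of CRSS Table III with `n ≥ 15` among them this gives the seed theorems `crssLowerPure_<n>_<k>` of the lower-column DAG (`Census/Additive/CRSSLowerN….lean`).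
Method: qec-type-02's `AddCert` certificates replayed by the LANE engine `Census/AdditiveCertLanes*.lean` (qec-search-5
on qec-type-01's `CertBZPlane`): per certificate the structural checks (`checkStructureL`, `decide`) and one
`decide +kernel` per lane segment (all Pauli words of weight `≤ d − 1` as bit-sliced lane families over the `3n` letter
rows), assembled by `AddCert.…_of_lanes`. Axioms standard (tier KERNEL-std); no `native_decide`.
Theorem names: `crssLower_<n>_<k> : AdditiveCodeExists n k d` (the cell, `d` = printed lower bound of CRSS Table III
[CalderbankEtAl1998, §8, printed pp. 32–33]) and `crssLowerPure_<n>_<k>` (purity, the input of CRSS Theorem 6 (b));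
for tree certificates also `isAdditiveCode_<cert>_std` / `minDistance_<cert>_std` / `exists_weight_<cert>_std`
(standard-axiom twins of the `native_decide` theorems). HONEST FRAMING: existence of `[[n, k, ≥ d]]` codes at the
printed value; optimality is the LP column (`Census/LPBounds/`). [folklore] for the certificates.
-/

namespace Summit.Ventures.QEC.Census.Additive

open Summit.Ventures.QEC.Census Literature.InformationTheory.QuantumCodes

/-- The tree certificate `certDcN16K0D6` (`[[16,0,6]]`, census id `DcN16K0D6`; its `check` was closed by `native_decide`) passes the structural checks of the lane form. [folklore] -/
theorem structL_certDcN16K0D6 : certDcN16K0D6.checkStructureL = true := by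
  decide

/-- Lane segment 0 of `certDcN16K0D6`: letter rows `[0, 48)` of `48`, 1925356 lanes (selections of `≤ 5` letter rows with largest row in the segment), syndrome planes + straggler re-check, one `decide +kernel`. [folklore] -/
theorem lane_certDcN16K0D6_0 :
    certDcN16K0D6.laneCheck 0 48 0 = true := by
  decide +kernel

/-- **`[[16,0,6]]` for `certDcN16K0D6.code` at tier KERNEL-std** (standard axioms; the statement of `isAdditiveCode_certDcN16K0D6` re-derived through the lane engine instead of `native_decide`). [folklore] -/
theorem isAdditiveCode_certDcN16K0D6_std : IsAdditiveCode certDcN16K0D6.code 0 6 :=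
  certDcN16K0D6.isAdditiveCode_of_lanes [(0, 48)] 0 structL_certDcN16K0D6 (by decide)
    (certDcN16K0D6.lanes_cons lane_certDcN16K0D6_0 (certDcN16K0D6.lanes_nil 0))

/-- … and (k = 0) a stabilizer of weight exactly `6` exists (KERNEL-std twin of `exists_weight_certDcN16K0D6`). [folklore] -/
theorem exists_weight_certDcN16K0D6_std : ∃ v ∈ certDcN16K0D6.code, sympWeight v = 6 :=
  certDcN16K0D6.exists_stabilizer_weight_eq_of_structureL structL_certDcN16K0D6 (by decide)

/-- **Cell `(16, 0)`: a (pure, by the `k = 0` convention) `[[16, 0, 6]]` additive code exists**, KERNEL-std — CRSS Table III lower bound; the standard-axiom form of this cell (its plain `AdditiveCodeExists` statement in the tree is the `native_decide` theorem of `certDcN16K0D6`). [cite: CalderbankEtAl1998, §8 Table III (printed pp. 32–33)] -/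
theorem crssLowerPure_16_0 : PureAdditiveCodeExists 16 0 6 :=
  pureAdditiveCodeExists_of_zero ⟨_, isAdditiveCode_certDcN16K0D6_std⟩

end Summit.Ventures.QEC.Census.Additive
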